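import Literature.MathematicalPhysics.QuantumFieldTheory.Balaban1983to89.B9Thm33G0DirXHolderAtPins
import Literature.MathematicalPhysics.QuantumFieldTheory.Balaban1983to89.B9GradViaDivLettersSmooth

/-!
# `Balaban1983to89.B9Thm33G0DirXHolderAtPinsSmooth` — [B9] Theorems 3.12–3.13 (pp. 421–426): THE W-c FACE `Thm33G0DirX.pXdDH` (Φ^X_β∘∇_{U,ν}∘G₀∘D_U, the N06
# certificate's displayed binder `hXd`) AT THE SMOOTH-PARTITION SOURCE CLASS `weightNorm (bHZ 1 p) (Lʲη)⁻¹`, k-level and background-generic: from print's (3.45) member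
# for ∇_νG₀∇\*_μ read at the smooth bond class `bHZK 1 p` (displayed, or the certificate's derived `Thm33G0Dir.h45m` under `bHX 1 = bHZK 1 p`) and dag-n06-l's smooth
# kinematic letter `J_μ(U) : bHZ → bHZK` (`B9GradViaDivLettersSmooth.hasMaj_JcoKH_smooth`)

T. Bałaban, *Propagators for lattice gauge theories in a background field*, Commun. Math. Phys. **99** (1985) 389–434
[`Balaban1985BackgroundPropagators`, "B9"]; [4] = T. Bałaban, *Propagators and renormalization transformations for lattice gauge
theories. II*, Commun. Math. Phys. **96** (1984) 223–250 [`Balaban1984PropagatorsII`].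

statement-level skeleton of published theorems with citation tags; proofs where landed; nothing here is a claim about the Yang–Mills
mass gap

THE PRINTED LOCI.  (3.45) p. 398 (*"‖ζ∇_UG(U)∇\*_Uλ‖_β ≦ B′₀(ε,β)(Lʲη)^{−β}(…)e^{−δ₀d(y,y′)}(‖λ‖_{β+ε} + |λ|)"*, *"ζ ∈ C₀^∞(Δ̃(y))"*, *"supp λ ⊂ Δ̃(y′)"*);
(3.43) p. 398 (the smooth localiser's cost *"(‖ζ‖^ξ_α + |ζ|)"*); (3.40) p. 397 (the Hölder quotient over near pairs); (3.3) p. 390 (`∇_{U,μ}`); p. 398, remark after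
(3.47) (*"λ replaced by a function J defined at bonds"*); pp. 421–423 (the left-form members of (3.130)∕(3.138)); [4] (2.51)–(2.56) pp. 232–233, Lemma 2.1
(2.60)–(2.61) p. 234.

THE POINT (cell `pub-ymgap`, node N06, width seat `pub-ymgap-dag-n06-w6` g3 — trigger (t1) of g2's HANDOFF).  Edition 39 of the N06 certificate displays exactly ONE
probe-valued Hölder member of rows 20–21, `hXd : … HasMaj (bH13 x) (𝔠_P^{(β−1)}) ((Φ^X_β∘Dd ν∘G₀)∘D_U) (BdX β·e^{−δ₃d})`, with its source class `bH13` FREE, because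
no pin of `bH13` inside the SHARP-cut class family is producible (g0′ «SHARP-CUT JUMPS»; g2 `B9CoReadingCoordsInputJump`).  The (F1) programme built the smooth-partition
classes `bHZ ε p` (sites) ∕ `bHZK ε p` (bonds) of `B9SmoothHolderClassS ∕ K` (κ = 1 + C_Lip(d, L), member-uniform) and dag-n06-l re-sourced the kinematic letter there
(`hasMaj_JcoKH_smooth`).  THIS FILE is the consumer half for the W-c face, at a k-level index `i` and for ANY background `B` read through `cfg : B.Cfg → CfgY 𝔸 i`
(node00-def-Y's road (α1): `bg9Y` and the class-parametric `bg9YR R₁ R₂` are both instances — member forms in `B9Thm33G0DirXHolderAtPinsSmoothMembers`):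
* ★★★ `pXdDH_smooth_of_h45` — THE PRIMITIVE: from print's (3.45) members for `Φ^X_β∘∇_ν∘G₀∘∇\*_μ` read at the smooth bond class `bHZK i 1 p` (input exponent 1 = β + (1−β);
  a displayed hypothesis schema `h45`, constants `BZ β`), the kinematic pins `hDv : Dv = DvcoKH i b B cfg U₁` ∕ `hDds : Dds = fun μ => coordOpK b (cdsBₗ μ)` (so
  `Dv = Σ_μ Dds μ ∘ₗ J_μ`, `DvcoKH_eq_sum`) and `hasMaj_JcoKH_smooth` (binders VERBATIM: `hβ1 hbI0`, contracting links `hU`, the small-gauge binder `hΘ` at exponent 1, the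
  enlargement radius `hN`, `0 ≤ δ_J`): `∀ ν β, 0 ≤ β → β < 1 → HasMaj (weightNorm (bHZ i 1 p) (len)⁻¹) (cNormR R₀ H₀ blkPX _ (β − 1)) ((Φ β ∘ₗ Dd ν ∘ₗ G0) ∘ₗ Dv) (BdX β·e^{−δ₃d})`
  for `BdX β ≥ (d+1)·((1 + C_Lip)·(BZ β·L₀)·((cR39 b·CJZ ℓ p ϑ·e^{δ_J·rZ d ℓ r})·L₀)·c)`, `0 ≤ δ₃ ≤ δ₀ − αδ`, `δ₃ + σ ≤ δ_J − αδ` (engine: g0′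
  `B9Thm33G0DirXHolderFromDds.pXdDH_of_h45m_noLen`, two [4]-(2.60) scale transfers);
* ★★ `pXdDH_smooth_of_thm33G0Dir` — the same from the certificate's DERIVED `Thm33G0Dir 𝔬 𝔭 Dd Dds R₀ H₀ bHX …` (its `h45m` at ε = 1 − β) when the input family reads the
  smooth class at exponent 1 (`hbHX1 : bHX 1 = bHZK i 1 p`), `BZ β := Bi2 (1−β) β`;
* ★ `thm33G0DirX_smooth_of_thm33G0Dir` — the WHOLE face `Thm33G0DirX 𝔬 𝔭 Dd R₀ H₀ _ (weightNorm (bHZ i 1 p) (len)⁻¹) Bx0 BdX δ₀′ δ₃ U₁` given the zeroth-order probe `pX0`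
  in its own shape (class-free; `B9Thm33G0ProbeZeroAtCutPins.pX0_of_pins`).
Why exponent 1: `pXdDH` quantifies over every β ∈ [0,1) with ONE source class; the J-letter keeps the exponent, so β + ε(β) must be constant, and ε(β) > 0 forces the
constant 1 (schedule ε β := 1 − β; print's B′₀(1−β, β) → ∞ as β → 1 is carried by `BZ β`).  Unlike g0′ §2's sharp twin (`pXdDH_pins_smallGauge`, NOT to be used as a
pin), a pin `bH13 := weightNorm (bHZ 1 p) (Lʲη)⁻¹` is HONEST: member-uniform cutting cost (`bHZ_κ`), no class-boundary jump.

HONEST SCOPE.  Kernel bookkeeping over landed modules; the (3.45)-type members (`h45` ∕ `Thm33G0Dir.h45m`), [4] Lemma 2.1 (`RowSum`), the member facts (`Facts347`), the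
gauge binder `hΘ` (GAUGE-VARIANT for flat classes — dag-n06-l `GAUGE-VARIANCE-MEMO`) and the radius `hN` are HYPOTHESES here; nothing of [B9] or [4] is asserted.
COUNT-NEUTRAL; `hXd` NOT discharged by this file alone (an edition must pin); N06 NOT discharged; one finite lattice at a time; nothing continuum, nothing about the mass
gap ∕ Clay.  Cell `pub-ymgap` (HUMAN RULING D-0062 ∕ D-0154), Track A node N06 [B9], W-c face `hXd`, width seat `pub-ymgap-dag-n06-w6` (g3), 2026-08-28.  NEW file;
nothing landed is modified.
-/

noncomputable section

namespace Literature.MathematicalPhysics.QuantumFieldTheory.Balaban1983to89.B9Thm33G0DirXHolderAtPinsSmooth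

open Node00 B6KLevelCensusIndexV1 B9BackgroundsKLevelV1
open B11SectG (HasMaj BlockNorm RowSum)
open B9SectDSup (weightNorm)
open B9Thm34Ext (toB6)
open B9Thm312Whole (GeoOK Ops)
open B9Thm312WholeClasses (cNormR)
open B9Thm312WholeDir (Thm33G0Dir)
open B9Thm312WholeStepDirFrom3131 (Thm33G0DirX)
open B9RWSums343Holder (HolderProbes)
open B9RWSums343to347Whole (Facts347)
open B9GeoNormsKLevelV1 (geo9K)
open B9CoReadingCoords (XBK coordOpK cdsBₗ)
open B9CoReadingCoordsS (XSK sIK)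
open Node00.OpsYSectDCoords (DvcoKH)
open B9GradViaDivLettersAtPins (JcoKH DvcoKH_eq_sum)
open B9GradViaDivLettersSmoothTerms (CJZ rZ)
open B9GradViaDivLettersSmooth (hasMaj_JcoKH_smooth)
open B9Thm33G0DirXHolderFromDds (pXdDH_of_h45m_noLen)
open B9Thm39ReadingCoords (cR39 cR39_nonneg)
open B9MultiscaleSmoothPartitionY (NearY)
open B9MultiscaleSmoothPartitionYLip (CLip CLip_nonneg)
open B9SmoothHolderClassS (bHZ)
open B9SmoothHolderClassK (bHZK bHZK_κ)
open B6GlobalChartV1 (PV blkV1)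
open B6Geom246MultiLevelTorus (geomT)

variable {𝔸 : Type} [NormedRing 𝔸] [NormedAlgebra ℂ 𝔸] [CompleteSpace 𝔸] [FiniteDimensional ℝ 𝔸]
variable {d ℓ : ℕ} {hd : 1 ≤ d + 1} {hL : Odd (ℓ + 1) ∧ 1 < ℓ + 1} {b₀ b₁ : ℝ}
variable (i : KIdx d ℓ hd hL b₀ b₁) [Fintype (geo9K i).Site]
variable {κ : Type} [Fintype κ] (b : Module.Basis κ ℝ 𝔸) (B : B9.Backgrounds) (cfg : B.Cfg → CfgY 𝔸 i)

/-! ## §1 ★★★ The primitive: from print's (3.45) members read at the smooth bond class and the smooth J-letter -/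

/-- ★★★ **`Thm33G0DirX.pXdDH` AT THE SMOOTH-PARTITION SOURCE CLASS FROM THE (3.45) MEMBERS AT THE SMOOTH BOND CLASS** — k-level, background-generic.  For ANY background
`B` read through `cfg` with contracting links `hU`, 1-faithful direction-blind `bI` (`hβ1`, `hbI0`), the small-gauge binder `hΘ` at exponent 1, the enlargement radius `hN`,
any `p ≥ 1`, any probe family `Φ β` with anchors `blkPX`, any `G0`, `Dd ν`: IF the (3.45) members hold from the smooth bond class — `h45 : ∀ ν μ β, HasMaj (bHZK i 1 p)
(ofBlocks blkPX) (Φ β ∘ₗ (Dd ν ∘ₗ (G0 ∘ₗ Dds μ))) (BZ β·len^{−β}·e^{−δ₀d})` (print's B′₀(1−β, β)(Lʲη)^{−β}e^{−δ₀d}, input exponent 1) — and `Dv`, `Dds` are the kinematic models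
(`hDv`, `hDds`; hence `Dv = Σ_μ Dds μ ∘ₗ J_μ(U₁)`), THEN `∀ ν β, 0 ≤ β → β < 1 → HasMaj (weightNorm (bHZ i 1 p) (len)⁻¹) (cNormR R₀ H₀ blkPX _ (β − 1)) ((Φ β ∘ₗ Dd ν ∘ₗ G0) ∘ₗ Dv)
(BdX β·e^{−δ₃d})` with `BdX β ≥ (d+1)·((1 + C_Lip d ℓ)·(BZ β·L₀)·((cR39 b·CJZ ℓ p ϑ·e^{δ_J·rZ d ℓ r})·L₀)·c)`, `0 ≤ δ_J`, `0 ≤ δ₃ ≤ δ₀ − αδ`, `δ₃ + σ ≤ δ_J − αδ`.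
[cite: Balaban1985BackgroundPropagators, Thm 3.3 (3.45) p.398 + (3.43) p.398 + (3.40) p.397 + (3.3) p.390 + p.398 (remark after (3.47)) + pp.421–423; Balaban1984PropagatorsII, (2.51)–(2.56) pp.232–233 + Lemma 2.1 (2.60)–(2.61) p.234] -/
theorem pXdDH_smooth_of_h45 {bI : FBondY i → IBondY i}
    (hβ1 : ∀ f : FBondY i, (geomT i.D).dist (B6Ineq2142KLevelV1.β i.hN i.D i.hk (bI f)) (blkV1 i.hN i.D f) ≤ 1)
    (hbI0 : ∀ f : FBondY i, bI f = bI ⟨f.src, 0⟩) {U₁ : B.Cfg}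
    (hU : ∀ (ν : Fin (d + 1)) (s : Site (PV d ℓ i.m i.K hd hL) 0), ‖(cfg U₁ ν s : 𝔸)‖ ≤ 1 ∧ ‖(((cfg U₁ ν s)⁻¹ : 𝔸ˣ) : 𝔸)‖ ≤ 1)
    {ϑ : ℝ} (hϑ : 0 ≤ ϑ)
    (hΘ : ∀ (μ : Fin (d + 1)) (s s' : Site (PV d ℓ i.m i.K hd hL) 0), Adm i ⟨s, μ⟩ ⟨s', μ⟩ →
      tpar i ⟨s, μ⟩ ⟨s', μ⟩ ^ (-(1 : ℝ)) * ‖(cfg U₁ μ s : 𝔸) - (cfg U₁ μ s' : 𝔸)‖ ≤ ϑ)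
    {r : ℝ} (hN : ∀ (y : IBondY i) (z : SiteY i), NearY i y z → (geo9K i).dist y (sIK i bI z) ≤ r)
    {p : ℝ} (h1p : 1 ≤ p)
    {R₀ : ℝ} {H₀ : Prop} (hG : GeoOK (geo9K i)) {σ c : ℝ} (hrow : RowSum (toB6 (geo9K i) R₀ H₀) σ c)
    {dF : ℕ} {δF α L₀ : ℝ} (hF : Facts347 (geo9K i) R₀ H₀ dF δF α L₀) {PX : Type} [Fintype PX] {blkPX : PX → (geo9K i).Site}
    {Φ : ℝ → ((XBK κ i → ℝ) →ₗ[ℝ] (PX → ℝ))} {G0 : Module.End ℝ (XBK κ i → ℝ)} {Dd Dds : Fin (d + 1) → Module.End ℝ (XBK κ i → ℝ)}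
    {Dv : (XSK κ i → ℝ) →ₗ[ℝ] (XBK κ i → ℝ)}
    (hDv : Dv = DvcoKH i b B cfg U₁) (hDds : Dds = fun μ => coordOpK b (fun _ : Fin (d + 1) => cdsBₗ i (cfg U₁) μ))
    {BZ : ℝ → ℝ} {δ₀ δJ δ₃ : ℝ} {BdX : ℝ → ℝ}
    (hBZ : ∀ β, 0 ≤ β → β < 1 → 0 ≤ BZ β) (hc : 0 ≤ c) (hδJ : 0 ≤ δJ)
    (hδ₃ : 0 ≤ δ₃) (hδ₃0 : δ₃ ≤ δ₀ - α * δF) (hδ₃J : δ₃ + σ ≤ δJ - α * δF)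
    (hBdX : ∀ β, 0 ≤ β → β < 1 →
      ((d : ℝ) + 1) * ((1 + CLip d ℓ) * (BZ β * L₀) * ((cR39 b * CJZ ℓ p ϑ * Real.exp (δJ * rZ d ℓ r)) * L₀) * c) ≤ BdX β)
    (h45 : ∀ (ν μ : Fin (d + 1)) (β : ℝ), 0 ≤ β → β < 1 →
      HasMaj (bHZK (κ := κ) i (R := R₀) (H := H₀) (zero_le_one : (0 : ℝ) ≤ 1) le_rfl h1p) (BlockNorm.ofBlocks (toB6 (geo9K i) R₀ H₀) blkPX)
        (Φ β ∘ₗ (Dd ν ∘ₗ (G0 ∘ₗ Dds μ))) (fun a a' => BZ β * (geo9K i).len a ^ (-β) * Real.exp (-(δ₀ * (geo9K i).dist a a')))) :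
    ∀ (ν : Fin (d + 1)) (β : ℝ), 0 ≤ β → β < 1 →
      HasMaj (weightNorm (bHZ (κ := κ) i (R := R₀) (H := H₀) (zero_le_one : (0 : ℝ) ≤ 1) le_rfl h1p) (fun y => ((geo9K i).len y)⁻¹)
          (fun y => inv_nonneg.mpr (hG.lenle y)))
        (cNormR R₀ H₀ blkPX hG.lenle (β - 1)) ((Φ β ∘ₗ Dd ν ∘ₗ G0) ∘ₗ Dv)
        (fun a a' => BdX β * Real.exp (-(δ₃ * (geo9K i).dist a a'))) := by
  intro ν β hβ0 hβ1'
  have hCJ : 0 ≤ cR39 b * CJZ ℓ p ϑ * Real.exp (δJ * rZ d ℓ r) := by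
    have := cR39_nonneg b
    have hCJZ : 0 ≤ CJZ ℓ p ϑ := by unfold CJZ; positivity
    positivity
  -- the kinematic decomposition at the pins (dag-n06-l): `Dv = Σ_μ Dds μ ∘ₗ J_μ(U₁)`
  have hDv' : Dv = ∑ μ, Dds μ ∘ₗ JcoKH i b B cfg μ U₁ := by
    rw [hDv, hDds]
    exact DvcoKH_eq_sum i b B cfg U₁
  have hBdX' : (Fintype.card (Fin (d + 1)) : ℝ) *
      ((1 + CLip d ℓ) * (BZ β * L₀) * ((cR39 b * CJZ ℓ p ϑ * Real.exp (δJ * rZ d ℓ r)) * L₀) * c) ≤ BdX β := by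
    rw [Fintype.card_fin, Nat.cast_add, Nat.cast_one]
    exact hBdX β hβ0 hβ1'
  exact pXdDH_of_h45m_noLen hG hrow hF (hBZ β hβ0 hβ1') hCJ hc (le_of_eq (bHZK_κ i zero_le_one le_rfl h1p)) hδ₃ hδ₃0 hδ₃J hBdX' hDv'
    (fun μ => h45 ν μ β hβ0 hβ1') (fun μ => hasMaj_JcoKH_smooth i b B cfg zero_le_one le_rfl h1p hβ1 hbI0 hU hϑ hΘ hN hδJ μ)

/-! ## §2 ★★ From the certificate's derived `Thm33G0Dir` when its input family reads the smooth class at exponent 1; the whole face -/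

/-- ★★ **`Thm33G0DirX.pXdDH` AT THE SMOOTH-PARTITION SOURCE CLASS FROM THE DERIVED `Thm33G0Dir`** — if `Thm33G0Dir 𝔬 𝔭 Dd Dds R₀ H₀ bHX …` (`h33`; its (3.45) member
`h45m`) reads its input family at exponent 1 as the smooth bond class (`hbHX1 : bHX 1 = bHZK i 1 p`, `1 ≤ p`) and `𝔬.Dv U₁`, `Dds U₁` are the kinematic models (`hDv`,
`hDds`), then under the binders of `pXdDH_smooth_of_h45` the field `∀ ν β, 0 ≤ β → β < 1 → HasMaj (weightNorm (bHZ i 1 p) (len)⁻¹) (cNormR R₀ H₀ 𝔭.blkPX _ (β − 1))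
((𝔭.ΦX U₁ β ∘ₗ Dd U₁ ν ∘ₗ 𝔬.G0 U₁) ∘ₗ 𝔬.Dv U₁) (BdX β·e^{−δ₃d})` holds with `BdX β ≥ (d+1)·((1 + C_Lip d ℓ)·(Bi2 (1−β) β·L₀)·((cR39 b·CJZ ℓ p ϑ·e^{δ_J·rZ d ℓ r})·L₀)·c)`
(schedule ε β := 1 − β).
[cite: Balaban1985BackgroundPropagators, Thm 3.3 (3.45) p.398 + (3.43) p.398 + (3.3) p.390 + p.398 (remark after (3.47)) + pp.421–423; Balaban1984PropagatorsII, (2.51)–(2.56) pp.232–233 + Lemma 2.1 (2.60)–(2.61) p.234] -/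
theorem pXdDH_smooth_of_thm33G0Dir {bI : FBondY i → IBondY i}
    (hβ1 : ∀ f : FBondY i, (geomT i.D).dist (B6Ineq2142KLevelV1.β i.hN i.D i.hk (bI f)) (blkV1 i.hN i.D f) ≤ 1)
    (hbI0 : ∀ f : FBondY i, bI f = bI ⟨f.src, 0⟩) {U₁ : B.Cfg}
    (hU : ∀ (ν : Fin (d + 1)) (s : Site (PV d ℓ i.m i.K hd hL) 0), ‖(cfg U₁ ν s : 𝔸)‖ ≤ 1 ∧ ‖(((cfg U₁ ν s)⁻¹ : 𝔸ˣ) : 𝔸)‖ ≤ 1)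
    {ϑ : ℝ} (hϑ : 0 ≤ ϑ)
    (hΘ : ∀ (μ : Fin (d + 1)) (s s' : Site (PV d ℓ i.m i.K hd hL) 0), Adm i ⟨s, μ⟩ ⟨s', μ⟩ →
      tpar i ⟨s, μ⟩ ⟨s', μ⟩ ^ (-(1 : ℝ)) * ‖(cfg U₁ μ s : 𝔸) - (cfg U₁ μ s' : 𝔸)‖ ≤ ϑ)
    {r : ℝ} (hN : ∀ (y : IBondY i) (z : SiteY i), NearY i y z → (geo9K i).dist y (sIK i bI z) ≤ r)
    {p : ℝ} (h1p : 1 ≤ p)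
    {R₀ : ℝ} {H₀ : Prop} (hG : GeoOK (geo9K i)) {σ c : ℝ} (hrow : RowSum (toB6 (geo9K i) R₀ H₀) σ c)
    {dF : ℕ} {δF α L₀ : ℝ} (hF : Facts347 (geo9K i) R₀ H₀ dF δF α L₀) {Z PX PY : Type} [Fintype PX] [Fintype PY]
    {𝔬 : Ops (geo9K i) B (XBK κ i) (XBK κ i) Z (XSK κ i)} {𝔭 : HolderProbes (geo9K i) B (XBK κ i) (XBK κ i) PX PY}
    {Dd Dds : B.Cfg → Fin (d + 1) → Module.End ℝ (XBK κ i → ℝ)}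
    {bHX : ℝ → BlockNorm (toB6 (geo9K i) R₀ H₀) (XBK κ i → ℝ)} {B₀ δ₀ : ℝ} {Bh Bi : ℝ → ℝ} {Bi2 : ℝ → ℝ → ℝ}
    (h33 : Thm33G0Dir 𝔬 𝔭 Dd Dds R₀ H₀ bHX B₀ Bh Bi Bi2 δ₀ U₁)
    (hbHX1 : bHX 1 = bHZK (κ := κ) i (R := R₀) (H := H₀) (zero_le_one : (0 : ℝ) ≤ 1) le_rfl h1p)
    (hDv : 𝔬.Dv U₁ = DvcoKH i b B cfg U₁)
    (hDds : Dds U₁ = fun μ => coordOpK b (fun _ : Fin (d + 1) => cdsBₗ i (cfg U₁) μ))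
    {δJ δ₃ : ℝ} {BdX : ℝ → ℝ}
    (hBi2 : ∀ e b', 0 < e → e ≤ 1 → 0 ≤ b' → b' < 1 → 0 ≤ Bi2 e b') (hc : 0 ≤ c) (hδJ : 0 ≤ δJ)
    (hδ₃ : 0 ≤ δ₃) (hδ₃0 : δ₃ ≤ δ₀ - α * δF) (hδ₃J : δ₃ + σ ≤ δJ - α * δF)
    (hBdX : ∀ β, 0 ≤ β → β < 1 →
      ((d : ℝ) + 1) * ((1 + CLip d ℓ) * (Bi2 (1 - β) β * L₀) * ((cR39 b * CJZ ℓ p ϑ * Real.exp (δJ * rZ d ℓ r)) * L₀) * c) ≤ BdX β) :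
    ∀ (ν : Fin (d + 1)) (β : ℝ), 0 ≤ β → β < 1 →
      HasMaj (weightNorm (bHZ (κ := κ) i (R := R₀) (H := H₀) (zero_le_one : (0 : ℝ) ≤ 1) le_rfl h1p) (fun y => ((geo9K i).len y)⁻¹)
          (fun y => inv_nonneg.mpr (hG.lenle y)))
        (cNormR R₀ H₀ 𝔭.blkPX hG.lenle (β - 1)) ((𝔭.ΦX U₁ β ∘ₗ Dd U₁ ν ∘ₗ 𝔬.G0 U₁) ∘ₗ 𝔬.Dv U₁)
        (fun a a' => BdX β * Real.exp (-(δ₃ * (geo9K i).dist a a'))) := by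
  refine pXdDH_smooth_of_h45 i b B cfg hβ1 hbI0 hU hϑ hΘ hN h1p hG hrow hF (Φ := 𝔭.ΦX U₁) (G0 := 𝔬.G0 U₁) (Dd := Dd U₁) (Dds := Dds U₁)
    hDv hDds (BZ := fun β => Bi2 (1 - β) β) (fun β h0 h1 => hBi2 (1 - β) β (by linarith) (by linarith) h0 h1) hc hδJ hδ₃ hδ₃0 hδ₃J hBdX ?_
  intro ν μ β hβ0 hβ1'
  have h := h33.h45m (ν, μ) (1 - β) β (by linarith) (by linarith) hβ0 hβ1'
  have e : β + (1 - β) = 1 := by ring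
  rw [e, hbHX1] at h
  exact h

/-- ★ **THE WHOLE W-c FACE `Thm33G0DirX` AT THE SMOOTH-PARTITION SOURCE CLASS**: `pXdDH_smooth_of_thm33G0Dir` + the zeroth-order probe `pX0` in its own shape
(class-free; supplied at node00-def-Y's cut probe carrier by `B9Thm33G0ProbeZeroAtCutPins.pX0_of_pins`) give
`Thm33G0DirX 𝔬 𝔭 Dd R₀ H₀ _ (weightNorm (bHZ i 1 p) (len)⁻¹) Bx0 BdX δ₀′ δ₃ U₁`.
[cite: Balaban1985BackgroundPropagators, Thm 3.3 p.399 + (3.42)–(3.45) pp.397–398 + (3.43) p.398 + (3.3) p.390 + pp.421–423; Balaban1984PropagatorsII, (2.51)–(2.56) pp.232–233 + Lemma 2.1 (2.60)–(2.61) p.234] -/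
theorem thm33G0DirX_smooth_of_thm33G0Dir {bI : FBondY i → IBondY i}
    (hβ1 : ∀ f : FBondY i, (geomT i.D).dist (B6Ineq2142KLevelV1.β i.hN i.D i.hk (bI f)) (blkV1 i.hN i.D f) ≤ 1)
    (hbI0 : ∀ f : FBondY i, bI f = bI ⟨f.src, 0⟩) {U₁ : B.Cfg}
    (hU : ∀ (ν : Fin (d + 1)) (s : Site (PV d ℓ i.m i.K hd hL) 0), ‖(cfg U₁ ν s : 𝔸)‖ ≤ 1 ∧ ‖(((cfg U₁ ν s)⁻¹ : 𝔸ˣ) : 𝔸)‖ ≤ 1)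
    {ϑ : ℝ} (hϑ : 0 ≤ ϑ)
    (hΘ : ∀ (μ : Fin (d + 1)) (s s' : Site (PV d ℓ i.m i.K hd hL) 0), Adm i ⟨s, μ⟩ ⟨s', μ⟩ →
      tpar i ⟨s, μ⟩ ⟨s', μ⟩ ^ (-(1 : ℝ)) * ‖(cfg U₁ μ s : 𝔸) - (cfg U₁ μ s' : 𝔸)‖ ≤ ϑ)
    {r : ℝ} (hN : ∀ (y : IBondY i) (z : SiteY i), NearY i y z → (geo9K i).dist y (sIK i bI z) ≤ r)
    {p : ℝ} (h1p : 1 ≤ p)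
    {R₀ : ℝ} {H₀ : Prop} (hG : GeoOK (geo9K i)) {σ c : ℝ} (hrow : RowSum (toB6 (geo9K i) R₀ H₀) σ c)
    {dF : ℕ} {δF α L₀ : ℝ} (hF : Facts347 (geo9K i) R₀ H₀ dF δF α L₀) {Z PX PY : Type} [Fintype PX] [Fintype PY]
    {𝔬 : Ops (geo9K i) B (XBK κ i) (XBK κ i) Z (XSK κ i)} {𝔭 : HolderProbes (geo9K i) B (XBK κ i) (XBK κ i) PX PY}
    {Dd Dds : B.Cfg → Fin (d + 1) → Module.End ℝ (XBK κ i → ℝ)}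
    {bHX : ℝ → BlockNorm (toB6 (geo9K i) R₀ H₀) (XBK κ i → ℝ)} {B₀ δ₀ : ℝ} {Bh Bi : ℝ → ℝ} {Bi2 : ℝ → ℝ → ℝ}
    (h33 : Thm33G0Dir 𝔬 𝔭 Dd Dds R₀ H₀ bHX B₀ Bh Bi Bi2 δ₀ U₁)
    (hbHX1 : bHX 1 = bHZK (κ := κ) i (R := R₀) (H := H₀) (zero_le_one : (0 : ℝ) ≤ 1) le_rfl h1p)
    (hDv : 𝔬.Dv U₁ = DvcoKH i b B cfg U₁)
    (hDds : Dds U₁ = fun μ => coordOpK b (fun _ : Fin (d + 1) => cdsBₗ i (cfg U₁) μ))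
    {δJ δ₃ δ₀' : ℝ} {Bx0 BdX : ℝ → ℝ}
    (hBi2 : ∀ e b', 0 < e → e ≤ 1 → 0 ≤ b' → b' < 1 → 0 ≤ Bi2 e b') (hc : 0 ≤ c) (hδJ : 0 ≤ δJ)
    (hδ₃ : 0 ≤ δ₃) (hδ₃0 : δ₃ ≤ δ₀ - α * δF) (hδ₃J : δ₃ + σ ≤ δJ - α * δF)
    (hBdX : ∀ β, 0 ≤ β → β < 1 →
      ((d : ℝ) + 1) * ((1 + CLip d ℓ) * (Bi2 (1 - β) β * L₀) * ((cR39 b * CJZ ℓ p ϑ * Real.exp (δJ * rZ d ℓ r)) * L₀) * c) ≤ BdX β)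
    (hpX0 : ∀ β : ℝ, 0 ≤ β → β < 1 → HasMaj (cNormR R₀ H₀ 𝔬.blk hG.lenle 0) (cNormR R₀ H₀ 𝔭.blkPX hG.lenle (β - 2))
      (𝔭.ΦX U₁ β ∘ₗ 𝔬.G0 U₁) (fun a a' => Bx0 β * Real.exp (-(δ₀' * (geo9K i).dist a a')))) :
    Thm33G0DirX 𝔬 𝔭 Dd R₀ H₀ hG.lenle
      (weightNorm (bHZ (κ := κ) i (R := R₀) (H := H₀) (zero_le_one : (0 : ℝ) ≤ 1) le_rfl h1p) (fun y => ((geo9K i).len y)⁻¹)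
        (fun y => inv_nonneg.mpr (hG.lenle y)))
      Bx0 BdX δ₀' δ₃ U₁ :=
  ⟨hpX0, pXdDH_smooth_of_thm33G0Dir i b B cfg hβ1 hbI0 hU hϑ hΘ hN h1p hG hrow hF h33 hbHX1 hDv hDds hBi2 hc hδJ hδ₃ hδ₃0 hδ₃J hBdX⟩

end Literature.MathematicalPhysics.QuantumFieldTheory.Balaban1983to89.B9Thm33G0DirXHolderAtPinsSmooth

end
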